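import Literature.Analysis.Complex.LogScaleLengthArea
import HarnessLib

/-!
# Conformal kit (K1): uniform length–area circle averaging and short images of short sets
reaching the boundary, for conformal maps onto the half-plane

Crux `Summit.CriticalPhenomena.CardyFormulaZ2.Theses.CardyUniqueLimit.CardyRigidity`
(stmt-CriticalPhenomena-0746), line `crossing_martingale`, helper kit for the heart
`stub_slitObservableApprox` (the conformal collars of the slit `4`-gons).  Pure complex analysis,
UNIFORM over the domain: only an area bound (K1a) or the displacement bound `‖g z - z‖ ≤ C₀` of
the hydrodynamically normalised Loewner maps (K1b) enters, never the regularity of the boundary.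

* (K1a) `exists_radius_short_image` — **Wolff's length–area circle averaging, uniform form**
  (Pommerenke 1992, Prop. 2.2, displays (4) and (6), for an arbitrary open set and centre): if
  `g` is holomorphic and injective on `U ∩ B(p, 1)` with `area g(U ∩ B(p, 1)) ≤ A`, then for
  `0 < d < 1` some radius `r ∈ (d, √d)` has `r · Λ_U(r) ≤ √(4 (2πA + 1) / log (1/d))`, where
  `r · Λ_U(r)` (`r * angLenAt U g p r` of the tree's `LengthAreaDiameter.lean`) is the total
  length of the `g`-image of the part of the circle `{|z - p| = r}` inside `U`; the integral
  form `∫₀¹ r Λ_U(r)² dr ≤ 2πA` is `lintegral_angLenAt_sq_le_area`; with the displacement bound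
  the constant is `4π (1 + C₀)/√(log (1/d))` (`exists_radius_short_image_of_displacement`).
* `exists_endpoints_of_arc` — at such a radius every arc of the circle inside `U` has a
  `g`-image of length `≤ L`: a `C¹` curve with endpoints, all within `L` of each other (the
  tree's `LengthArea.exists_tendsto_nhdsGT` / `dist_le_of_tendsto`).
* (K1b) `exists_real_forall_dist_le_of_closure` — **short connected sets reaching the boundary
  have short images next to `ℝ`**: for a conformal bijection `g : U → ℍ` with continuous
  inverse `f` and `‖g z - z‖ ≤ C₀`, a preconnected `Q ⊆ U ∩ B(p, d)` (`0 < d < 1`) whose closure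
  meets `ℂ ∖ U` has `g(Q) ⊆ B̄(x, 8π (1 + C₀)/√(log (1/d)))` for some REAL `x` (the tree's
  `LengthArea.norm_sub_le_of_isPreconnected` plus properness of `g` towards `∂U`, which is
  automatic: boundary accumulation values of `g` are real because `f` is continuous on `ℍ`);
  corollaries `im_le_of_closure` and the pointwise form `im_le_of_dist_lt`:
  **`im g(q) ≤ 8π (1 + C₀)/√(log (1/d))` whenever `dist q (ℂ ∖ U) < d < 1`** (the uniform
  "Euclidean-close to the boundary ⇒ conformally close to `ℝ`").

References: Ch. Pommerenke, *Boundary Behaviour of Conformal Maps* (1992), Prop. 2.2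
[PommerenkeBBCM1992]; G. F. Lawler, *Conformally Invariant Processes in the Plane* (2005), §3.4
(3.12), §3.7 (3.21) [Lawler2005].
-/

noncomputable section

open Set Filter Metric MeasureTheory Real
open _root_.Complex _root_.Topology
open UpperHalfPlane (upperHalfPlaneSet)
open scoped ENNReal NNReal
open Literature.Analysis.Complex.LengthArea

namespace Summit.CriticalPhenomena.CardyFormulaZ2.Cruxes.CardyRigidity.CrossingMartingale

namespace ConformalKit

variable {U : Set ℂ} {g : ℂ → ℂ} {p : ℂ}

/-! ### (K1a) Circle averaging, uniform form -/

/-- For `|r| < 1` the circle of radius `r` about `p` lies in `B(p, 1)`, so the speed density of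
`g` along it is the same for `U` and for `U ∩ B(p, 1)`. [folklore] -/
theorem derOn_inter_ball_circleMap {r : ℝ} (hr : |r| < 1) (t : ℝ) :
    derOn (U ∩ ball p 1) g (circleMap p r t) = derOn U g (circleMap p r t) := by
  have hmem : circleMap p r t ∈ ball p 1 := by
    rw [mem_ball, dist_eq_norm, circleMap_sub_center, norm_circleMap_zero]; exact hr
  by_cases hU : circleMap p r t ∈ U
  · rw [derOn, derOn, indicator_of_mem (show circleMap p r t ∈ U ∩ ball p 1 from ⟨hU, hmem⟩),
      indicator_of_mem hU]
  · rw [derOn, derOn, indicator_of_notMem (fun h ↦ hU h.1), indicator_of_notMem hU]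

/-- For `|r| < 1` the angular length `Λ(r)` is the same for `U` and for `U ∩ B(p, 1)`. [folklore] -/
theorem angLenAt_inter_ball {r : ℝ} (hr : |r| < 1) :
    angLenAt (U ∩ ball p 1) g p r = angLenAt U g p r := by
  simp only [angLenAt, derOn_inter_ball_circleMap hr]

/-- **The length–area inequality with an area bound, integral form**: if `g` is holomorphic and
injective on `U ∩ B(p, 1)` with `area g(U ∩ B(p, 1)) ≤ A`, then `∫₀¹ r Λ_U(r)² dr ≤ 2πA`, where
`r Λ_U(r)` is the length of the `g`-image of `U ∩ {|z - p| = r}` (Pommerenke (1992), Prop. 2.2,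
display (6)). [cite: PommerenkeBBCM1992, Prop. 2.2, (6)] -/
theorem lintegral_angLenAt_sq_le_area (hU : IsOpen U) (hg : DifferentiableOn ℂ g (U ∩ ball p 1))
    (hinj : InjOn g (U ∩ ball p 1)) {A : ℝ}
    (hA : volume (g '' (U ∩ ball p 1)) ≤ ENNReal.ofReal A) :
    ∫⁻ r in Ioo (0 : ℝ) 1, ENNReal.ofReal r * angLenAt U g p r ^ 2 ≤ ENNReal.ofReal (2 * π * A) := by
  have hU'o : IsOpen (U ∩ ball p 1) := hU.inter isOpen_ball
  calc ∫⁻ r in Ioo (0 : ℝ) 1, ENNReal.ofReal r * angLenAt U g p r ^ 2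
      = ∫⁻ r in Ioo (0 : ℝ) 1, ENNReal.ofReal r * angLenAt (U ∩ ball p 1) g p r ^ 2 := by
        refine setLIntegral_congr_fun measurableSet_Ioo fun r hr ↦ ?_
        rw [angLenAt_inter_ball (by rw [abs_of_pos hr.1]; exact hr.2)]
    _ ≤ ∫⁻ r in Ioi (0 : ℝ), ENNReal.ofReal r * angLenAt (U ∩ ball p 1) g p r ^ 2 :=
        lintegral_mono_set fun r hr ↦ hr.1
    _ ≤ ENNReal.ofReal (2 * π) * volume (g '' (U ∩ ball p 1)) :=
        lintegral_angLenAt_sq_le hU'o hg hinj p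
    _ ≤ ENNReal.ofReal (2 * π) * ENNReal.ofReal A := by gcongr
    _ = ENNReal.ofReal (2 * π * A) := by rw [← ENNReal.ofReal_mul (by positivity)]

/-- **(K1a) Wolff's length–area circle averaging, uniform form.** If `g` is holomorphic and
injective on `U ∩ B(p, 1)` (`U` open, `p` any centre) with `area g(U ∩ B(p, 1)) ≤ A`, then for
`0 < d < 1` there is a radius `r ∈ (d, √d)` at which the total length `r Λ_U(r)` of the
`g`-image of `U ∩ {|z - p| = r}` is at most `√(4 (2πA + 1) / log (1/d))` (pigeonhole on
`∫ r Λ(r)² dr ≤ 2πA` over `(d, √d)`, where `∫ dr/r = ½ log (1/d)`; Pommerenke (1992), Prop. 2.2,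
display (4)).  The bound depends on `g` only through `A`. [cite: PommerenkeBBCM1992, Prop. 2.2] -/
theorem exists_radius_short_image (hU : IsOpen U) (hg : DifferentiableOn ℂ g (U ∩ ball p 1))
    (hinj : InjOn g (U ∩ ball p 1)) {A : ℝ} (hA0 : 0 ≤ A)
    (hA : volume (g '' (U ∩ ball p 1)) ≤ ENNReal.ofReal A) {d : ℝ} (hd : 0 < d) (hd1 : d < 1) :
    ∃ r ∈ Ioo d (√d), ENNReal.ofReal r * angLenAt U g p r ≤
      ENNReal.ofReal (√(4 * (2 * π * A + 1) / Real.log (1 / d))) := by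
  have hU'o : IsOpen (U ∩ ball p 1) := hU.inter isOpen_ball
  have hK : ∫⁻ r in Ioi (0 : ℝ), ENNReal.ofReal r * angLenAt (U ∩ ball p 1) g p r ^ 2 ≤
      ENNReal.ofReal (2 * π * A) := by
    calc ∫⁻ r in Ioi (0 : ℝ), ENNReal.ofReal r * angLenAt (U ∩ ball p 1) g p r ^ 2
        ≤ ENNReal.ofReal (2 * π) * volume (g '' (U ∩ ball p 1)) :=
          lintegral_angLenAt_sq_le hU'o hg hinj p
      _ ≤ ENNReal.ofReal (2 * π) * ENNReal.ofReal A := by gcongr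
      _ = ENNReal.ofReal (2 * π * A) := by rw [← ENNReal.ofReal_mul (by positivity)]
  obtain ⟨r, hr, hlen⟩ := exists_mem_Ioo_mul_le hK ENNReal.ofReal_ne_top hd hd1
  rw [ENNReal.toReal_ofReal (by positivity)] at hlen
  have hsd1 : √d < 1 := (Real.sqrt_lt' one_pos).2 (by simpa using hd1)
  have hr1 : |r| < 1 := by rw [abs_of_pos (hd.trans hr.1)]; exact hr.2.trans hsd1
  exact ⟨r, hr, by rwa [angLenAt_inter_ball hr1] at hlen⟩

/-- A map moving points by at most `C₀` maps `U ∩ B(p, 1)` into `B(p, 1 + C₀)`, of area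
`π (1 + C₀)²`. [folklore] -/
theorem volume_image_inter_ball_le {C₀ : ℝ} (hC₀ : 0 ≤ C₀) (hC : ∀ z ∈ U, ‖g z - z‖ ≤ C₀) :
    volume (g '' (U ∩ ball p 1)) ≤ ENNReal.ofReal ((1 + C₀) ^ 2 * π) := by
  have himg : g '' (U ∩ ball p 1) ⊆ ball p (1 + C₀) := by
    rintro _ ⟨z, ⟨hzU, hz⟩, rfl⟩
    rw [mem_ball, dist_eq_norm] at hz ⊢
    calc ‖g z - p‖ = ‖(g z - z) + (z - p)‖ := by ring_nf
      _ ≤ ‖g z - z‖ + ‖z - p‖ := norm_add_le _ _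
      _ < C₀ + 1 := add_lt_add_of_le_of_lt (hC z hzU) hz
      _ = 1 + C₀ := add_comm _ _
  refine (measure_mono himg).trans (le_of_eq ?_)
  rw [Complex.volume_ball, ENNReal.ofReal_mul (by positivity), ← ENNReal.ofReal_pow (by positivity),
    ← NNReal.coe_real_pi, ENNReal.ofReal_coe_nnreal]

/-- The Wolff bound for area `π (1 + C₀)²` is at most `4π (1 + C₀)/√(log (1/d))`. [folklore] -/
theorem sqrt_wolff_le {C₀ d : ℝ} (hC₀ : 0 ≤ C₀) (hd : 0 < d) (hd1 : d < 1) :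
    √(4 * (2 * π * ((1 + C₀) ^ 2 * π) + 1) / Real.log (1 / d)) ≤
      4 * π * (1 + C₀) / √(Real.log (1 / d)) := by
  have hlog : 0 < Real.log (1 / d) := Real.log_pos (by rw [lt_div_iff₀ hd]; linarith)
  rw [Real.sqrt_div' _ hlog.le, div_le_div_iff_of_pos_right (Real.sqrt_pos.2 hlog)]
  have hπ : (2 : ℝ) ≤ π := Real.two_le_pi
  have hC1 : (1 : ℝ) ≤ (1 + C₀) ^ 2 := by nlinarith
  have hπ2 : (4 : ℝ) ≤ π ^ 2 := by nlinarith
  have hkey : 4 * (2 * π * ((1 + C₀) ^ 2 * π) + 1) ≤ (4 * π * (1 + C₀)) ^ 2 := by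
    nlinarith [mul_le_mul hπ2 hC1 (by norm_num) (by positivity)]
  calc √(4 * (2 * π * ((1 + C₀) ^ 2 * π) + 1)) ≤ √((4 * π * (1 + C₀)) ^ 2) :=
        Real.sqrt_le_sqrt hkey
    _ = 4 * π * (1 + C₀) := Real.sqrt_sq (by positivity)

/-- **(K1a) with the displacement bound.** If `g` is holomorphic and injective on the open set
`U` and `‖g z - z‖ ≤ C₀` on `U` (the hydrodynamically normalised Loewner maps `g_t : ℍ ∖ K_t → ℍ`,
Lawler (2005), (3.12)), then for every centre `p` and `0 < d < 1` some `r ∈ (d, √d)` has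
`r Λ_U(r) ≤ 4π (1 + C₀)/√(log (1/d))`. [cite: PommerenkeBBCM1992, Prop. 2.2] -/
theorem exists_radius_short_image_of_displacement (hU : IsOpen U) (hg : DifferentiableOn ℂ g U)
    (hinj : InjOn g U) {C₀ : ℝ} (hC₀ : 0 ≤ C₀) (hC : ∀ z ∈ U, ‖g z - z‖ ≤ C₀) {d : ℝ}
    (hd : 0 < d) (hd1 : d < 1) :
    ∃ r ∈ Ioo d (√d), ENNReal.ofReal r * angLenAt U g p r ≤
      ENNReal.ofReal (4 * π * (1 + C₀) / √(Real.log (1 / d))) := by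
  obtain ⟨r, hr, hlen⟩ := exists_radius_short_image hU (hg.mono inter_subset_left)
    (hinj.mono inter_subset_left) (by positivity) (volume_image_inter_ball_le hC₀ hC) hd hd1
  exact ⟨r, hr, hlen.trans (ENNReal.ofReal_le_ofReal (sqrt_wolff_le hC₀ hd hd1))⟩

/-! ### Arcs of a good circle: finite length, endpoints -/

/-- The `g`-image of the circle has derivative `g'(p + re^{it}) · (ire^{it})` in the angle at
points of the open set `U` where `g` is holomorphic. [folklore] -/
theorem hasDerivAt_comp_circleMap (hU : IsOpen U) (hg : DifferentiableOn ℂ g U) {r t : ℝ}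
    (ht : circleMap p r t ∈ U) :
    HasDerivAt (fun s ↦ g (circleMap p r s)) (deriv g (circleMap p r t) * (circleMap 0 r t * I)) t :=
  (hg.differentiableAt (hU.mem_nhds ht)).hasDerivAt.comp t (hasDerivAt_circleMap p r t)

/-- **The length of the image of an arc inside `U` is at most `r Λ_U(r)`**: for an arc
`{p + re^{it} : t ∈ (θ₁, θ₂)} ⊆ U` (`θ₁ ∈ [-π, π]`, `θ₂ ≤ θ₁ + 2π`),
`∫_{θ₁}^{θ₂} ‖(g ∘ circle)'‖ ≤ r Λ_U(r)`. [folklore] -/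
theorem lintegral_arc_le {r : ℝ} (hr : 0 < r) {θ₁ θ₂ : ℝ}
    (hθ₁ : θ₁ ∈ Icc (-π) π) (h2 : θ₂ ≤ θ₁ + 2 * π) (harc : ∀ t ∈ Ioo θ₁ θ₂, circleMap p r t ∈ U) :
    ∫⁻ s in Ioo θ₁ θ₂, ‖deriv g (circleMap p r s) * (circleMap 0 r s * I)‖ₑ ≤
      ENNReal.ofReal r * angLenAt U g p r := by
  have hper : ∀ t, derOn U g (circleMap p r (t + 2 * π)) = derOn U g (circleMap p r t) :=
    fun t ↦ by rw [periodic_circleMap]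
  have hwin : ∫⁻ t in Ioc θ₁ (θ₁ + 2 * π), derOn U g (circleMap p r t) = angLenAt U g p r := by
    rw [Literature.Analysis.Complex.LogScaleLengthArea.setLIntegral_Ioc_eq_of_periodic
      (h := fun t ↦ derOn U g (circleMap p r t)) (T := 2 * π) hper (θ₀ := -π) (θ₁ := θ₁) hθ₁.1
      (by linarith [hθ₁.2]), show -π + 2 * π = π by ring, angLenAt]
    exact setLIntegral_congr Ioo_ae_eq_Ioc.symm
  calc ∫⁻ s in Ioo θ₁ θ₂, ‖deriv g (circleMap p r s) * (circleMap 0 r s * I)‖ₑ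
      = ∫⁻ s in Ioo θ₁ θ₂, derOn U g (circleMap p r s) * ENNReal.ofReal r := by
        refine setLIntegral_congr_fun measurableSet_Ioo fun s hs ↦ ?_
        rw [enorm_mul, derOn, indicator_of_mem (harc s hs), ofReal_norm,
          ← ofReal_norm (circleMap 0 r s * I), norm_circleMap_zero_mul_I, abs_of_pos hr]
    _ = (∫⁻ s in Ioo θ₁ θ₂, derOn U g (circleMap p r s)) * ENNReal.ofReal r :=
        lintegral_mul_const' _ _ ENNReal.ofReal_ne_top
    _ ≤ (∫⁻ s in Ioc θ₁ (θ₁ + 2 * π), derOn U g (circleMap p r s)) * ENNReal.ofReal r := by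
        gcongr
        exact fun s hs ↦ ⟨hs.1, hs.2.le.trans h2⟩
    _ = ENNReal.ofReal r * angLenAt U g p r := by rw [hwin, mul_comm]

/-- **Arcs of a good circle have short images with endpoints.** Let `g` be holomorphic on the
open set `U`, `r > 0`, `r Λ_U(r) ≤ L`, and `{p + re^{it} : t ∈ (θ₁, θ₂)} ⊆ U` an arc
(`θ₁ ∈ [-π, π]`, `θ₁ < θ₂ ≤ θ₁ + 2π`).  Then the image curve `c(t) = g(p + re^{it})` has limits
`a` at `θ₁⁺` and `b` at `θ₂⁻`, every point of it is within `L` of `a` and of every other point,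
and `dist a b ≤ L` (curves of finite length have endpoints: the tree's
`LengthArea.exists_tendsto_nhdsGT`, `dist_le_of_tendsto`). [cite: PommerenkeBBCM1992, Prop. 2.2] -/
theorem exists_endpoints_of_arc (hU : IsOpen U) (hg : DifferentiableOn ℂ g U) {r : ℝ} (hr : 0 < r)
    {L : ℝ} (hL : 0 ≤ L) (hlen : ENNReal.ofReal r * angLenAt U g p r ≤ ENNReal.ofReal L)
    {θ₁ θ₂ : ℝ} (hθ₁ : θ₁ ∈ Icc (-π) π) (h12 : θ₁ < θ₂) (h2 : θ₂ ≤ θ₁ + 2 * π)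
    (harc : ∀ t ∈ Ioo θ₁ θ₂, circleMap p r t ∈ U) :
    ∃ a b : ℂ, Tendsto (fun t ↦ g (circleMap p r t)) (𝓝[>] θ₁) (𝓝 a) ∧
      Tendsto (fun t ↦ g (circleMap p r t)) (𝓝[<] θ₂) (𝓝 b) ∧
      (∀ t ∈ Ioo θ₁ θ₂, dist (g (circleMap p r t)) a ≤ L) ∧
      (∀ s ∈ Ioo θ₁ θ₂, ∀ t ∈ Ioo θ₁ θ₂, dist (g (circleMap p r s)) (g (circleMap p r t)) ≤ L) ∧
      dist a b ≤ L := by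
  set c : ℝ → ℂ := fun t ↦ g (circleMap p r t) with hc
  set c' : ℝ → ℂ := fun t ↦ deriv g (circleMap p r t) * (circleMap 0 r t * I) with hc'
  have hderiv : ∀ s ∈ Ioo θ₁ θ₂, HasDerivAt c (c' s) s := fun s hs ↦
    hasDerivAt_comp_circleMap hU hg (harc s hs)
  have hcont : ContinuousOn c' (Ioo θ₁ θ₂) := by
    have hd : ContinuousOn (deriv g) U := ((hg.analyticOnNhd hU).deriv).continuousOn
    refine (hd.comp (continuous_circleMap p r).continuousOn harc).mul ?_
    exact Continuous.continuousOn (by unfold circleMap; fun_prop)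
  have hLint : ∫⁻ s in Ioo θ₁ θ₂, ‖c' s‖ₑ ≤ ENNReal.ofReal L :=
    (lintegral_arc_le hr hθ₁ h2 harc).trans hlen
  have hLtop : ∫⁻ s in Ioo θ₁ θ₂, ‖c' s‖ₑ ≠ ⊤ := ne_top_of_le_ne_top ENNReal.ofReal_ne_top hLint
  have hLε : (∫⁻ s in Ioo θ₁ θ₂, ‖c' s‖ₑ).toReal ≤ L := ENNReal.toReal_le_of_le_ofReal hL hLint
  obtain ⟨a, ha⟩ := exists_tendsto_nhdsGT h12 hderiv hcont hLtop
  obtain ⟨b, hb⟩ := exists_tendsto_nhdsLT h12 hderiv hcont hLtop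
  refine ⟨a, b, ha, hb, fun t ht ↦ (dist_le_of_tendsto hderiv hcont hLtop ha h12 ht).trans hLε,
    fun s hs t ht ↦ (dist_le_of_lintegral hderiv hcont hLtop hs ht).trans hLε,
    (dist_le_of_tendsto_of_tendsto hderiv hcont hLtop ha hb h12).trans hLε⟩

/-! ### (K1b) Short connected sets reaching the boundary have short images next to `ℝ` -/

section Boundary

variable {f : ℂ → ℂ} {C₀ d : ℝ} {Q : Set ℂ}

/-- **Boundary accumulation values of `g` are real** (properness of `g : U → ℍ` towards `∂U`,
automatic from the continuity of the inverse `f` on `ℍ`): if `zₙ ∈ U`, `zₙ → b ∉ U` and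
`g zₙ → w`, then `im w = 0`. [folklore] -/
theorem im_eq_zero_of_tendsto (hgU : MapsTo g U upperHalfPlaneSet)
    (hfU : MapsTo f upperHalfPlaneSet U) (hfc : ContinuousOn f upperHalfPlaneSet)
    (hfg : ∀ z ∈ U, f (g z) = z) {ι : Type*} {l : Filter ι} [NeBot l] {z : ι → ℂ}
    (hz : ∀ i, z i ∈ U) {b : ℂ} (hb : b ∉ U) (hzb : Tendsto z l (𝓝 b)) {w : ℂ}
    (hw : Tendsto (fun i ↦ g (z i)) l (𝓝 w)) : w.im = 0 := by
  have hge : 0 ≤ w.im :=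
    ge_of_tendsto ((continuous_im.tendsto w).comp hw)
      (Eventually.of_forall fun i ↦ (le_of_lt (hgU (hz i)) : (0 : ℝ) ≤ (g (z i)).im))
  refine le_antisymm (not_lt.1 fun hpos ↦ hb ?_) hge
  have hwH : w ∈ upperHalfPlaneSet := hpos
  have hin : Tendsto (fun i ↦ g (z i)) l (𝓝[upperHalfPlaneSet] w) :=
    tendsto_nhdsWithin_iff.2 ⟨hw, Eventually.of_forall fun i ↦ hgU (hz i)⟩
  have hlim : Tendsto (fun i ↦ f (g (z i))) l (𝓝 (f w)) := (hfc w hwH).tendsto.comp hin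
  have heq : (fun i ↦ f (g (z i))) = z := funext fun i ↦ hfg _ (hz i)
  rw [heq] at hlim
  rw [tendsto_nhds_unique hzb hlim]
  exact hfU hwH

/-- **(K1b) Short connected sets reaching the boundary have short images next to `ℝ`.** Let
`U ⊆ ℂ` be open, `g` holomorphic on `U` with `g(U) ⊆ ℍ`, `f : ℍ → U` a continuous inverse, and
`‖g z - z‖ ≤ C₀` on `U`.  If `Q ⊆ U ∩ B(p, d)` (`0 < d < 1`) is preconnected and its closure
contains a point `b ∉ U`, then `g(Q)` lies in the closed disc of radius
`8π (1 + C₀)/√(log (1/d))` about a REAL point `x` (a boundary accumulation value of `g` along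
`Q`; the tree's `LengthArea.norm_sub_le_of_isPreconnected` bounds `diam g(Q)`, and accumulation
values at `∂U` are real by `im_eq_zero_of_tendsto`). [cite: PommerenkeBBCM1992, Prop. 2.2] -/
theorem exists_real_forall_dist_le_of_closure (hU : IsOpen U) (hg : DifferentiableOn ℂ g U)
    (hgU : MapsTo g U upperHalfPlaneSet) (hfU : MapsTo f upperHalfPlaneSet U)
    (hfc : ContinuousOn f upperHalfPlaneSet) (hgf : ∀ w ∈ upperHalfPlaneSet, g (f w) = w)
    (hfg : ∀ z ∈ U, f (g z) = z) (hC : ∀ z ∈ U, ‖g z - z‖ ≤ C₀) (hd : 0 < d) (hd1 : d < 1)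
    (hQ : IsPreconnected Q) (hQU : Q ⊆ U) (hQd : Q ⊆ ball p d) {b : ℂ} (hbQ : b ∈ closure Q)
    (hbU : b ∉ U) :
    ∃ x : ℝ, ∀ z ∈ Q, dist (g z) x ≤ 8 * π * (1 + C₀) / √(Real.log (1 / d)) := by
  -- a sequence of `Q` tending to `b`, and a convergent subsequence of its images
  obtain ⟨u, huQ, hub⟩ := mem_closure_iff_seq_limit.1 hbQ
  have hC₀ : ∀ n, ‖g (u n) - u n‖ ≤ C₀ := fun n ↦ hC _ (hQU (huQ n))
  have hbd : ∀ n, g (u n) ∈ closedBall p (d + C₀) := fun n ↦ by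
    rw [mem_closedBall, dist_eq_norm]
    have h1 : ‖u n - p‖ < d := by rw [← dist_eq_norm]; exact hQd (huQ n)
    calc ‖g (u n) - p‖ = ‖(g (u n) - u n) + (u n - p)‖ := by ring_nf
      _ ≤ ‖g (u n) - u n‖ + ‖u n - p‖ := norm_add_le _ _
      _ ≤ C₀ + d := add_le_add (hC₀ n) h1.le
      _ = d + C₀ := add_comm _ _
  obtain ⟨w, -, φ, hφ, hw⟩ := (isCompact_closedBall p (d + C₀)).tendsto_subseq hbd
  have him : w.im = 0 :=
    im_eq_zero_of_tendsto hgU hfU hfc hfg (fun n ↦ hQU (huQ (φ n))) hbU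
      (hub.comp hφ.tendsto_atTop) hw
  refine ⟨w.re, fun z hz ↦ ?_⟩
  have hwre : ((w.re : ℝ) : ℂ) = w := by
    apply Complex.ext <;> simp [him]
  rw [hwre]
  have hlim : Tendsto (fun n ↦ dist (g z) (g (u (φ n)))) atTop (𝓝 (dist (g z) w)) :=
    tendsto_const_nhds.dist hw
  refine le_of_tendsto hlim (Eventually.of_forall fun n ↦ ?_)
  rw [dist_eq_norm]
  exact norm_sub_le_of_isPreconnected hU hg hgU hfU hfc hgf hfg hC hd hd1 hQ hQU hQd hz
    (huQ (φ n))

/-- **(K1b), imaginary parts**: under the hypotheses of `exists_real_forall_dist_le_of_closure`,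
`im g(z) ≤ 8π (1 + C₀)/√(log (1/d))` on `Q`. [cite: PommerenkeBBCM1992, Prop. 2.2] -/
theorem im_le_of_closure (hU : IsOpen U) (hg : DifferentiableOn ℂ g U)
    (hgU : MapsTo g U upperHalfPlaneSet) (hfU : MapsTo f upperHalfPlaneSet U)
    (hfc : ContinuousOn f upperHalfPlaneSet) (hgf : ∀ w ∈ upperHalfPlaneSet, g (f w) = w)
    (hfg : ∀ z ∈ U, f (g z) = z) (hC : ∀ z ∈ U, ‖g z - z‖ ≤ C₀) (hd : 0 < d) (hd1 : d < 1)
    (hQ : IsPreconnected Q) (hQU : Q ⊆ U) (hQd : Q ⊆ ball p d) {b : ℂ} (hbQ : b ∈ closure Q)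
    (hbU : b ∉ U) {z : ℂ} (hz : z ∈ Q) :
    (g z).im ≤ 8 * π * (1 + C₀) / √(Real.log (1 / d)) := by
  obtain ⟨x, hx⟩ := exists_real_forall_dist_le_of_closure hU hg hgU hfU hfc hgf hfg hC hd hd1
    hQ hQU hQd hbQ hbU
  have h := hx z hz
  rw [dist_eq_norm] at h
  calc (g z).im = (g z - (x : ℂ)).im := by simp
    _ ≤ |(g z - (x : ℂ)).im| := le_abs_self _
    _ ≤ ‖g z - (x : ℂ)‖ := abs_im_le_norm _
    _ ≤ _ := h

/-- **(K1b), pointwise form: Euclidean-close to `ℂ ∖ U` ⇒ conformally close to `ℝ`.** Under the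
hypotheses of `exists_real_forall_dist_le_of_closure`, every `q ∈ U` within distance `d < 1` of a
point `b ∉ U` has `im g(q) ≤ 8π (1 + C₀)/√(log (1/d))` (apply (K1b) to the half-open segment
from `q` to a nearest point of `ℂ ∖ U`, which lies in `U`).  For the Loewner maps
`g_t : ℍ ∖ K_t → ℍ` (`C₀ = 3 rad K_t`) this is the uniform decay of `im g_t` at `K_t ∪ ℝ`.
[cite: PommerenkeBBCM1992, Prop. 2.2] -/
theorem im_le_of_dist_lt (hU : IsOpen U) (hg : DifferentiableOn ℂ g U)
    (hgU : MapsTo g U upperHalfPlaneSet) (hfU : MapsTo f upperHalfPlaneSet U)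
    (hfc : ContinuousOn f upperHalfPlaneSet) (hgf : ∀ w ∈ upperHalfPlaneSet, g (f w) = w)
    (hfg : ∀ z ∈ U, f (g z) = z) (hC : ∀ z ∈ U, ‖g z - z‖ ≤ C₀) (hd : 0 < d) (hd1 : d < 1)
    {q b : ℂ} (hq : q ∈ U) (hb : b ∉ U) (hqb : dist q b < d) :
    (g q).im ≤ 8 * π * (1 + C₀) / √(Real.log (1 / d)) := by
  -- a nearest point `b'` of the complement
  have hSc : IsClosed Uᶜ := hU.isClosed_compl
  obtain ⟨b', hb'S, hb'⟩ := hSc.exists_infDist_eq_dist (⟨b, hb⟩ : (Uᶜ : Set ℂ).Nonempty) q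
  have hqb' : dist q b' < d := by
    rw [← hb']; exact (infDist_le_dist_of_mem (hb : b ∈ Uᶜ)).trans_lt hqb
  have hpos : 0 < dist q b' := dist_pos.2 (fun h ↦ hb'S (h ▸ hq))
  -- the half-open segment `[q, b')`
  set γ : ℝ → ℂ := fun s ↦ q + s * (b' - q) with hγ
  have hγc : Continuous γ := by rw [hγ]; fun_prop
  set Q : Set ℂ := γ '' Ico 0 1 with hQdef
  have hQc : IsPreconnected Q := isPreconnected_Ico.image γ hγc.continuousOn
  have hdistq : ∀ s : ℝ, 0 ≤ s → dist (γ s) q = s * dist q b' := fun s hs ↦ by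
    rw [hγ, dist_eq_norm, dist_eq_norm, show q + s * (b' - q) - q = s * (b' - q) by ring,
      norm_mul, Complex.norm_real, Real.norm_eq_abs, abs_of_nonneg hs, norm_sub_rev]
  have hdistb : ∀ s : ℝ, s ≤ 1 → dist (γ s) b' = (1 - s) * dist q b' := fun s hs ↦ by
    rw [hγ, dist_eq_norm, dist_eq_norm,
      show q + s * (b' - q) - b' = ((1 - s : ℝ) : ℂ) * (q - b') by push_cast; ring,
      norm_mul, Complex.norm_real, Real.norm_eq_abs, abs_of_nonneg (by linarith)]
  have hQU : Q ⊆ U := by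
    rintro _ ⟨s, hs, rfl⟩
    by_contra hnot
    have h1 : infDist q Uᶜ ≤ dist q (γ s) := infDist_le_dist_of_mem hnot
    rw [hb', dist_comm q (γ s), hdistq s hs.1] at h1
    have h2 : s * dist q b' < 1 * dist q b' := mul_lt_mul_of_pos_right hs.2 hpos
    linarith
  have hQd : Q ⊆ ball b' d := by
    rintro _ ⟨s, hs, rfl⟩
    rw [mem_ball, hdistb s hs.2.le]
    calc (1 - s) * dist q b' ≤ 1 * dist q b' :=
          mul_le_mul_of_nonneg_right (by linarith [hs.1]) dist_nonneg
      _ < d := by rw [one_mul]; exact hqb'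
  have hbQ : b' ∈ closure Q := by
    have h1 : Tendsto γ (𝓝[<] (1 : ℝ)) (𝓝 (γ 1)) :=
      (hγc.tendsto 1).mono_left nhdsWithin_le_nhds
    have hγ1 : γ 1 = b' := by simp [hγ]
    rw [hγ1] at h1
    refine mem_closure_of_tendsto h1 ?_
    filter_upwards [Ico_mem_nhdsLT one_pos] with s hs
    exact ⟨s, hs, rfl⟩
  have hqQ : q ∈ Q := ⟨0, ⟨le_rfl, one_pos⟩, by simp [hγ]⟩
  exact im_le_of_closure hU hg hgU hfU hfc hgf hfg hC hd hd1 hQc hQU hQd hbQ hb'S hqQ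

end Boundary

end ConformalKit

/-- **Registered form** (anchor `conformalKit_exists_radius_short_image` of stmt-CriticalPhenomena-0746, (K1a)):
Wolff's length–area circle averaging, uniform over univalent maps with an area bound — for `g` holomorphic and
injective on `U ∩ B(p, 1)` with `area g(U ∩ B(p, 1)) ≤ A` and `0 < d < 1`, some `r ∈ (d, √d)` has image length
`r Λ_U(r) ≤ √(4 (2πA + 1)/log (1/d))`. [cite: PommerenkeBBCM1992, Prop. 2.2] -/
theorem conformalKit_exists_radius_short_image : ∀ (U : Set ℂ) (g : ℂ → ℂ) (p : ℂ) (A d : ℝ), IsOpen U → DifferentiableOn ℂ g (U ∩ Metric.ball p 1) → Set.InjOn g (U ∩ Metric.ball p 1) → 0 ≤ A → MeasureTheory.volume (g '' (U ∩ Metric.ball p 1)) ≤ ENNReal.ofReal A → 0 < d → d < 1 → ∃ r ∈ Set.Ioo d (Real.sqrt d), ENNReal.ofReal r * Literature.Analysis.Complex.LengthArea.angLenAt U g p r ≤ ENNReal.ofReal (Real.sqrt (4 * (2 * Real.pi * A + 1) / Real.log (1 / d))) :=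
  fun _ _ _ _ _ hU hg hinj hA0 hA hd hd1 ↦ ConformalKit.exists_radius_short_image hU hg hinj hA0 hA hd hd1

end Summit.CriticalPhenomena.CardyFormulaZ2.Cruxes.CardyRigidity.CrossingMartingale
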